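import Mathlib.NumberTheory.NumberField.CMField
import Summits.Ventures.HodgeRepro2.T5QuadraticGenerator

/-!
# The `(θ, y)` datum of a CM field exists — non-vacuity of the standing hypotheses of the record's local pair

Tier-5 support N3 / §G-N4.2 (seat p3, gen 77). The statements of files 231–234 (and of the `T5FinitePlace*` files
they rest on) carry the standing datum `θ : K⁺`, `y : K` with `algebraMap K⁺ K θ = y ^ 2` and `complexConj K y ≠ y`
(«`K = K⁺(√θ)`»), and the generator datum `l : Fin r → 𝓞 K` of the tensor lattice with
`Submodule.span (𝓞 K⁺) (Set.range l) = ⊤` (files 228–231). This file shows that BOTH data exist for EVERY CM field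
(README §10.5 (ii)(c): the hypotheses quantify over an inhabited carrier), so that every theorem of the record's
local pair stated on `(θ, y, l)` has a `(θ, y, l)`-free corollary:

* `exists_complexConj_ne` — some `y₀ ∈ K` is moved by the complex conjugation (Mathlib's `complexConj_ne_one`);
* `complexConj_sub_complexConj` — `y := y₀ − c(y₀)` satisfies `c(y) = −y`;
* `sq_mem_maximalRealSubfield_of_complexConj_eq_neg` — `c(y) = −y ⇒ y ^ 2 ∈ K⁺`;
* **`exists_sq_eq_and_complexConj_ne`** — `∃ θ y, algebraMap K⁺ K θ = y ^ 2 ∧ complexConj K y ≠ y` (the exact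
  hypothesis pair `(hθ, hy)` of files 231–234), with the sharper `exists_sq_eq_and_complexConj_eq_neg`
  (`c(y) = −y` and `y ≠ 0`);
* **`exists_integer_sq_eq_and_complexConj_ne`** — the integral form, `θ ∈ 𝓞_{K⁺}` and `y ∈ 𝓞_K`, through seat
  p8's `T5QuadraticGenerator.exists_sq_eq_algebraMap`;
* **`exists_fin_span_eq_top`** — `∃ r (l : Fin r → 𝓞 K), Submodule.span (𝓞 K⁺) (Set.range l) = ⊤` (Mathlib's
  `IsNoetherian (𝓞 K⁺) (𝓞 K)`);
* `exists_datum` — the two data together.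

§8(d): uses an L-value-free non-vanishing device: NO.
-/

open NumberField NumberField.IsCMField

namespace Summit.Ventures.HodgeRepro2.T5CMFieldSquareDatum

variable (K : Type*) [Field K] [NumberField K] [IsCMField K]

/-- Some element of a CM field is moved by the complex conjugation (Mathlib's `complexConj_ne_one`). -/
theorem exists_complexConj_ne : ∃ y : K, complexConj K y ≠ y := by
  by_contra h
  simp only [not_exists, not_not] at h
  exact complexConj_ne_one K (AlgEquiv.ext fun x => (h x).trans (AlgEquiv.one_apply x).symm)

variable {K}

/-- `y₀ − c(y₀)` is sent to its negative by the complex conjugation. -/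
theorem complexConj_sub_complexConj (y₀ : K) :
    complexConj K (y₀ - complexConj K y₀) = -(y₀ - complexConj K y₀) := by
  rw [map_sub, complexConj_apply_apply, neg_sub]

/-- If `c(y) = −y` then `y ^ 2` lies in the maximal real subfield (Mathlib's `complexConj_eq_self_iff`). -/
theorem sq_mem_maximalRealSubfield_of_complexConj_eq_neg {y : K} (h : complexConj K y = -y) :
    y ^ 2 ∈ maximalRealSubfield K := by
  rw [← complexConj_eq_self_iff, map_pow, h, neg_sq]

/-- `c(y) = −y` and `y ≠ 0` give `c(y) ≠ y` (characteristic `0`). -/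
theorem complexConj_ne_of_eq_neg {y : K} (h : complexConj K y = -y) (hy : y ≠ 0) :
    complexConj K y ≠ y := by
  rw [h]
  exact fun h' => hy (CharZero.neg_eq_self_iff.mp h')

variable (K)

/-- **The datum exists, sharp form**: there are `θ ∈ K⁺` and `y ∈ K`, `y ≠ 0`, with `θ = y ^ 2` and `c(y) = −y`
(`y := y₀ − c(y₀)` for any `y₀` moved by `c`). -/
theorem exists_sq_eq_and_complexConj_eq_neg :
    ∃ (θ : maximalRealSubfield K) (y : K),
      algebraMap (maximalRealSubfield K) K θ = y ^ 2 ∧ complexConj K y = -y ∧ y ≠ 0 := by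
  obtain ⟨y₀, hy₀⟩ := exists_complexConj_ne K
  exact ⟨⟨(y₀ - complexConj K y₀) ^ 2,
    sq_mem_maximalRealSubfield_of_complexConj_eq_neg (complexConj_sub_complexConj y₀)⟩,
    y₀ - complexConj K y₀, rfl, complexConj_sub_complexConj y₀, sub_ne_zero.mpr hy₀.symm⟩

/-- **THE DATUM `(θ, y)` OF THE RECORD EXISTS FOR EVERY CM FIELD**: `∃ θ : K⁺, ∃ y : K`,
`algebraMap K⁺ K θ = y ^ 2 ∧ complexConj K y ≠ y` — exactly the hypothesis pair `(hθ, hy)` of files 231–234. -/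
theorem exists_sq_eq_and_complexConj_ne :
    ∃ (θ : maximalRealSubfield K) (y : K),
      algebraMap (maximalRealSubfield K) K θ = y ^ 2 ∧ complexConj K y ≠ y :=
  (exists_sq_eq_and_complexConj_eq_neg K).elim fun θ h => h.elim fun y h =>
    ⟨θ, y, h.1, complexConj_ne_of_eq_neg h.2.1 h.2.2⟩

/-- **The integral form**: `θ ∈ 𝓞_{K⁺}` and `y ∈ 𝓞_K` (seat p8's `exists_sq_eq_algebraMap` on the quadratic
extension `K / K⁺`, `[K : K⁺] = 2` by Mathlib's `IsQuadraticExtension.finrank_eq_two`; `c(y) ≠ y` because `y` is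
not an integer of `K⁺`, Mathlib's `RingOfIntegers.complexConj_eq_self_iff`). -/
theorem exists_integer_sq_eq_and_complexConj_ne :
    ∃ (d : 𝓞 (maximalRealSubfield K)) (x : 𝓞 K),
      algebraMap (maximalRealSubfield K) K
          (algebraMap (𝓞 (maximalRealSubfield K)) (maximalRealSubfield K) d) = (algebraMap (𝓞 K) K x) ^ 2 ∧
      complexConj K (algebraMap (𝓞 K) K x) ≠ algebraMap (𝓞 K) K x := by
  obtain ⟨x, d, hxd, hx⟩ := T5QuadraticGenerator.exists_sq_eq_algebraMap (K := maximalRealSubfield K) (L := K)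
    (Algebra.IsQuadraticExtension.finrank_eq_two _ K)
  refine ⟨d, x, ?_, fun h => hx ?_⟩
  · rw [← IsScalarTower.algebraMap_apply, sq, ← map_mul, hxd,
      IsScalarTower.algebraMap_apply (𝓞 (maximalRealSubfield K)) (𝓞 K) K]
  · obtain ⟨y', hy'⟩ := (NumberField.IsCMField.RingOfIntegers.complexConj_eq_self_iff K x).mp h
    refine ⟨y', RingOfIntegers.coe_injective ?_⟩
    rw [← IsScalarTower.algebraMap_apply]
    exact hy'

omit [IsCMField K] in
/-- **The generator datum exists**: `𝓞_K` is a finitely generated `𝓞_{K⁺}`-module (Mathlib's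
`IsNoetherian (𝓞 K⁺) (𝓞 K)`), so some `l : Fin r → 𝓞 K` spans it — the hypothesis `hl` of files 228–234. -/
theorem exists_fin_span_eq_top :
    ∃ (r : ℕ) (l : Fin r → 𝓞 K), Submodule.span (𝓞 (maximalRealSubfield K)) (Set.range l) = ⊤ :=
  Module.Finite.exists_fin

/-- **The whole standing datum of the record's local pair is inhabited**: `(θ, y)` with `θ = y ^ 2`, `c(y) ≠ y`,
and generators `l` of `𝓞_K` over `𝓞_{K⁺}`. -/
theorem exists_datum :
    ∃ (θ : maximalRealSubfield K) (y : K) (r : ℕ) (l : Fin r → 𝓞 K),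
      algebraMap (maximalRealSubfield K) K θ = y ^ 2 ∧ complexConj K y ≠ y ∧
        Submodule.span (𝓞 (maximalRealSubfield K)) (Set.range l) = ⊤ :=
  (exists_sq_eq_and_complexConj_ne K).elim fun θ h => h.elim fun y h =>
    (exists_fin_span_eq_top K).elim fun r h' => h'.elim fun l hl => ⟨θ, y, r, l, h.1, h.2, hl⟩

end Summit.Ventures.HodgeRepro2.T5CMFieldSquareDatum
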